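import Summits.Ventures.HSemireg.Mod4CarrierMiddleDegree
import Summits.Ventures.HSemireg.WedgeWeilPurityOneSided

/-!
# Venture HSemireg — MOD-4 line: `rank M_f = rank(H_n Ω_n H_n)` and THEOREM R_f's ONE-SIDED MIDDLE DEGREE with `+ rank M_f`
# ON THE p4 CARRIER (the sheet's wording «R_n = r_n(C(2n,n) − 2) + C(2n,n) + rank M_f», one W-coordinate `0`)

HONEST FRAMING. Part of the Lean index of the computation cell `pub-hsemireg` (widening group W3, seat w3-mod4-1 gen 7; file of
record `HOME/widen/W3/MOD4-OFFSPLIT-w3mod4.md` §10.2 (one-sided clause), §12.8).  Explicit `(n+1) × (n+1)` matrices over a field and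
finite-dimensional exterior algebra ONLY (g4's `Mod4.hankelT` / `Mod4.middleM`, th-7's `Hsq` / `Omega`, p4's carrier of Weil type `(n,n)`):
no abelian variety, no sheaf, no Ext group, no semiregularity map; nothing here says that HC, HC_CM or HC_AV holds; no Literature fact is
declared or used.  WHAT IS PROVED (proof-only): (1) MATRICES — `S·D·J = Ω_n` EXACTLY (`signS_mul_binomD_mul_revJ`: g4's sign / binomial
diagonals and antidiagonal unit against th-7's pairing matrix `Omega`), `hankelH = Hsq` (`hankelH_eq_Hsq`), hence with g4's `T_f = J·H·S·D`
(`hankelT_eq_mul`): **`T_f² = J · (H_n Ω_n H_n) · (S·D)`** (`hankelT_mul_hankelT`), and since `J² = 1` and `det(S·D) = Π_i (−1)^i C(n,i)`: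
**`rank M_f = rank(H_n(q) Ω_n H_n(q))`** whenever the binomials `C(n,i)` are non-zero in `K` (`rank_middleM_eq`; `M_f = (−1)ⁿT_f²`,
g4's `middleM_eq_smul_hankelT_sq`), in particular in characteristic `0` (`rank_middleM_eq_charZero`).  (2) CARRIER — THEOREM R_f's
one-sided middle degree ON p4's CARRIER in the sheet's form, both sides (`n ≥ 1`, every `q`, binomials non-zero in `K` resp. characteristic `0`):
**`dim S_n(Ecl q (2n) + a·w₊) + 2·r_n + C(2n,n) = C(2n,n)·r_n + 2·C(2n,n) + rank M_f(q)`** (`finrank_S_weil_nn_one_middle_Mf`, `a ≠ 0`) and the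
same for `Ecl q (2n) + b·w₋` (`finrank_S_weil_nn_low_middle_Mf`, `b ≠ 0`) — th-7's `weilPurity_oneSided_b_zero` / `_a_zero` through seat g6's
exact transport `finrank_S_eq_model_nn`, with `rank(H_n Ω_n H_n)` rewritten as `rank M_f`; i.e. `R_n = r_n(C(2n,n) − 2) + C(2n,n) + rank M_f`.
All statements and proofs: w3-mod4-1 g7 (2026-08-24).  Namespace `Summit.Ventures.HSemireg.Mod4Carrier`.
References: [BuchweitzFlenner2008HH] Prop. 6.4.4 (why these operators); [BourbakiAlgebre1a3] Ch. III §7, §11 no. 9.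
-/

open Module

namespace Summit.Ventures.HSemireg.Mod4Carrier

/-! ### 1. Matrices: `S·D·J = Ω_n`, `T_f² = J·(H Ω H)·(S D)`, `rank M_f = rank(H Ω H)` -/

section Matrices

open Matrix Summit.Ventures.HSemireg.Mod4 Summit.Ventures.HSemireg.Wedge.Weil

variable (K : Type*) [Field K] (n : ℕ)

/-- **`S·D·J = Ω_n`:** g4's `signS n * binomD n * revJ n` is th-7's pairing matrix `Omega K n`
(`Ω_{l,m} = [l + m = n]·(−1)^{n−m}·C(n,m)`; uses `C(n,n−m) = C(n,m)`). -/
lemma signS_mul_binomD_mul_revJ : (signS n * binomD n * revJ n : Matrix (Fin (n + 1)) (Fin (n + 1)) K) = Omega K n := by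
  ext l m
  rw [mul_revJ_apply, signS, binomD, diagonal_mul_diagonal, diagonal_apply, Omega, Matrix.of_apply]
  have hm : (m : ℕ) ≤ n := Nat.lt_succ_iff.mp m.isLt
  by_cases h : l = m.rev
  · subst h
    rw [if_pos rfl, val_rev', if_pos (by omega), Nat.choose_symm hm]
  · have h' : ¬ ((l : ℕ) + (m : ℕ) = n) := fun e => h (Fin.ext (by rw [val_rev']; omega))
    rw [if_neg h, if_neg h']

omit [Field K] in
/-- g4's middle Hankel matrix is th-7's `Hsq`. -/
lemma hankelH_eq_Hsq (q : ℕ → K) : hankelH n q = Hsq K n q := by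
  ext a b
  rfl

/-- **`T_f² = J · (H_n Ω_n H_n) · (S·D)`** (`T_f = J·H·S·D`, `S·D·J = Ω_n`). -/
lemma hankelT_mul_hankelT (q : ℕ → K) :
    hankelT n q * hankelT n q = revJ n * (Hsq K n q * Omega K n * Hsq K n q) * (signS n * binomD n) := by
  rw [hankelT_eq_mul, ← signS_mul_binomD_mul_revJ K n, hankelH_eq_Hsq]
  simp only [Matrix.mul_assoc]

/-- `det J` is a unit (`J² = 1`). -/
lemma isUnit_det_revJ : IsUnit (revJ n : Matrix (Fin (n + 1)) (Fin (n + 1)) K).det :=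
  IsUnit.of_mul_eq_one (revJ n : Matrix (Fin (n + 1)) (Fin (n + 1)) K).det
    (by rw [← Matrix.det_mul, revJ_mul_revJ, Matrix.det_one])

/-- `det(S·D) = Π_i (−1)^i·C(n,i)` is a unit when the binomials are non-zero in `K`. -/
lemma isUnit_det_signS_mul_binomD (hC : ∀ i : Fin (n + 1), (n.choose (i : ℕ) : K) ≠ 0) :
    IsUnit (signS n * binomD n : Matrix (Fin (n + 1)) (Fin (n + 1)) K).det := by
  rw [signS, binomD, diagonal_mul_diagonal, det_diagonal, isUnit_iff_ne_zero]
  exact Finset.prod_ne_zero_iff.mpr fun i _ => mul_ne_zero (pow_ne_zero _ (neg_ne_zero.mpr one_ne_zero)) (hC i)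

/-- a non-zero scalar does not change the rank. -/
lemma rank_smul_of_ne_zero {c : K} (hc : c ≠ 0) (X : Matrix (Fin (n + 1)) (Fin (n + 1)) K) : (c • X).rank = X.rank := by
  have h : c • X = (c • (1 : Matrix (Fin (n + 1)) (Fin (n + 1)) K)) * X := by rw [Matrix.smul_mul, Matrix.one_mul]
  rw [h]
  refine rank_mul_eq_right_of_isUnit_det _ _ ?_
  rw [det_smul, det_one, mul_one, isUnit_iff_ne_zero]
  exact pow_ne_zero _ hc

/-- **`rank M_f = rank(H_n(q) Ω_n H_n(q))`** when the binomials `C(n,i)` are non-zero in `K`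
(`M_f = (−1)ⁿ·T_f²`, `T_f² = J·(H Ω H)·(S D)`, `J` and `S·D` invertible). [cite: BuchweitzFlenner2008HH, Prop. 6.4.4] -/
theorem rank_middleM_eq (q : ℕ → K) (hC : ∀ i : Fin (n + 1), (n.choose (i : ℕ) : K) ≠ 0) :
    (middleM n q).rank = (Hsq K n q * Omega K n * Hsq K n q).rank := by
  rw [middleM_eq_smul_hankelT_sq, rank_smul_of_ne_zero K n (pow_ne_zero _ (neg_ne_zero.mpr one_ne_zero)), hankelT_mul_hankelT,
    rank_mul_eq_left_of_isUnit_det _ _ (isUnit_det_signS_mul_binomD K n hC),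
    rank_mul_eq_right_of_isUnit_det _ _ (isUnit_det_revJ K n)]

/-- in characteristic `0` the binomials `C(n,i)`, `i ≤ n`, are non-zero. -/
lemma choose_cast_ne_zero [CharZero K] (i : Fin (n + 1)) : (n.choose (i : ℕ) : K) ≠ 0 :=
  Nat.cast_ne_zero.mpr (Nat.choose_pos (Nat.lt_succ_iff.mp i.isLt)).ne'

/-- **`rank M_f = rank(H_n Ω_n H_n)` in characteristic `0`.** -/
theorem rank_middleM_eq_charZero [CharZero K] (q : ℕ → K) :
    (middleM n q).rank = (Hsq K n q * Omega K n * Hsq K n q).rank :=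
  rank_middleM_eq K n q (choose_cast_ne_zero K n)

end Matrices

/-! ### 2. Carrier: the one-sided middle degree with `+ rank M_f` -/

section Carrier

open Summit.Ventures.HSemireg.WedgeBridge Summit.Ventures.HSemireg.WeilCarrier
open Summit.Ventures.HSemireg.Wedge.Hankel Summit.Ventures.HSemireg.Wedge.Weil Summit.Ventures.HSemireg.Mod4

variable {K : Type*} [Field K] {n : ℕ} {V : Type*} [AddCommGroup V] [Module K V] (bV : Basis (Fin ((n + n) + (n + n))) K V)

/-- **THEOREM R_f ONE-SIDED, `a`-SIDE, MIDDLE DEGREE ON THE CARRIER with `rank M_f`** (`n ≥ 1`, `a ≠ 0`, every `q`, binomials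
`C(n,i)` non-zero in `K`): `dim S_n(Ecl q (2n) + a·w₊) + 2·r_n + C(2n,n) = C(2n,n)·r_n + 2·C(2n,n) + rank M_f(q)`, i.e.
`R_n = r_n(C(2n,n) − 2) + C(2n,n) + rank M_f`. [cite: BuchweitzFlenner2008HH, Prop. 6.4.4] -/
theorem finrank_S_weil_nn_one_middle_Mf (hn : 1 ≤ n) (q : ℕ → K) {a : K} (ha : a ≠ 0)
    (hC : ∀ i : Fin (n + 1), (n.choose (i : ℕ) : K) ≠ 0) :
    Module.finrank K (S K (Lsp bV) n (Ecl bV q (n + n) + a • wUp bV n)) +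
        2 * (hankel1 K (n + n) n q).rank + (n + n).choose n =
      (n + n).choose n * (hankel1 K (n + n) n q).rank + ((n + n).choose n + (n + n).choose n) + (middleM n q).rank := by
  have ha' : (-1 : K) ^ (n * n) * a ≠ 0 := mul_ne_zero (pow_ne_zero _ (neg_ne_zero.mpr one_ne_zero)) ha
  have h := finrank_S_eq_model_nn bV q a 0 n
  rw [zero_smul, add_zero] at h
  rw [h, rank_middleM_eq K n q hC]
  exact weilPurity_oneSided_b_zero K hn q ha'

/-- **THEOREM R_f ONE-SIDED, `b`-SIDE, MIDDLE DEGREE ON THE CARRIER with `rank M_f`** (`n ≥ 1`, `b ≠ 0`, every `q`, binomials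
non-zero in `K`): `dim S_n(Ecl q (2n) + b·w₋) + 2·r_n + C(2n,n) = C(2n,n)·r_n + 2·C(2n,n) + rank M_f(q)`. [cite: BuchweitzFlenner2008HH, Prop. 6.4.4] -/
theorem finrank_S_weil_nn_low_middle_Mf (hn : 1 ≤ n) (q : ℕ → K) {b : K} (hb : b ≠ 0)
    (hC : ∀ i : Fin (n + 1), (n.choose (i : ℕ) : K) ≠ 0) :
    Module.finrank K (S K (Lsp bV) n (Ecl bV q (n + n) + b • wLow bV n)) +
        2 * (hankel1 K (n + n) n q).rank + (n + n).choose n =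
      (n + n).choose n * (hankel1 K (n + n) n q).rank + ((n + n).choose n + (n + n).choose n) + (middleM n q).rank := by
  have h := finrank_S_eq_model_nn bV q 0 b n
  rw [zero_smul, add_zero, mul_zero] at h
  rw [h, rank_middleM_eq K n q hC]
  exact weilPurity_oneSided_a_zero K hn q hb

/-- characteristic `0`, `a`-side: `dim S_n(Ecl q (2n) + a·w₊) + 2·r_n + C(2n,n) = C(2n,n)·r_n + 2·C(2n,n) + rank M_f(q)`. -/
theorem finrank_S_weil_nn_one_middle_Mf_charZero [CharZero K] (hn : 1 ≤ n) (q : ℕ → K) {a : K} (ha : a ≠ 0) :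
    Module.finrank K (S K (Lsp bV) n (Ecl bV q (n + n) + a • wUp bV n)) +
        2 * (hankel1 K (n + n) n q).rank + (n + n).choose n =
      (n + n).choose n * (hankel1 K (n + n) n q).rank + ((n + n).choose n + (n + n).choose n) + (middleM n q).rank :=
  finrank_S_weil_nn_one_middle_Mf bV hn q ha (choose_cast_ne_zero K n)

/-- characteristic `0`, `b`-side: `dim S_n(Ecl q (2n) + b·w₋) + 2·r_n + C(2n,n) = C(2n,n)·r_n + 2·C(2n,n) + rank M_f(q)`. -/
theorem finrank_S_weil_nn_low_middle_Mf_charZero [CharZero K] (hn : 1 ≤ n) (q : ℕ → K) {b : K} (hb : b ≠ 0) :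
    Module.finrank K (S K (Lsp bV) n (Ecl bV q (n + n) + b • wLow bV n)) +
        2 * (hankel1 K (n + n) n q).rank + (n + n).choose n =
      (n + n).choose n * (hankel1 K (n + n) n q).rank + ((n + n).choose n + (n + n).choose n) + (middleM n q).rank :=
  finrank_S_weil_nn_low_middle_Mf bV hn q hb (choose_cast_ne_zero K n)

end Carrier

end Summit.Ventures.HSemireg.Mod4Carrier
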